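import Summits.HodgeConjecture.HodgeConjecture.Theorems.GenericDivisibilityGenericDivisibilityBoundedBirationalUp
import Summits.HodgeConjecture.HodgeConjecture.Theorems.GenericDivisibilityGenericDivisibilityBoundedHeartDescent
import HarnessLib

/-!
# The heart of line `finite-level-bootstrap` (crux C2, stmt-HodgeConjecture-18467) ASCENDS along
# birational morphisms: a clean level is a birational invariant of smooth projective varieties

Registered sub-goal `stub_heartOfBirationalUp` (lead c5). Sorry-free, definition-free.
`σ : X' ⟶ X` is a `ℂ`-morphism of smooth projective `n`-folds with `σ.left` birational (an
isomorphism over a dense open `U ⊆ X`), `σ(ℂ) = AlgPoints.mapContinuous σ`, `H = H^k(–(ℂ); ℤ)`,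
`z| = z|_{(X∖Z)(ℂ)}`. As in the sibling files, spelled inline: "`x ∈ GT(X)`" (generically torsion):
`∃ Z` closed `≠ univ`, `∃ N ≥ 1`, `N • x| = 0`; "`D'(m, z)`": `∃ Z` closed `≠ univ`, `∃ y`,
`∃ M ≥ 1`, `M • (z| - m • y) = 0`; "level `ℓ^s` is CLEAN at `X` in degree `k`":
`∀ z, D'(ℓ^s, z) → ∃ w, z - ℓ • w ∈ GT(X)`. The landed `…HeartDescent` proves that a clean level
DESCENDS along `σ`; this file proves that it ASCENDS, so that **the heart `stub_finiteLevel` at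
`(ℓ, s)` is a birational invariant of smooth projective `2p`-folds**.

## The argument (Voisin I, proof of Thm. 7.31 first step; Fulton, Lemma 19.1.2)

Let `σ_! = gysinMap (complexOrientationInt hX') (complexOrientationInt hX) σ(ℂ)` be the INTEGRAL
Gysin map, of degree one (`hasDegree_one_complexOrientationInt_of_isBirational`), so `σ_! σ^* = id`
(`gysinMap_map_of_hasDegree`). For `z'` on `X'` put `z = σ_! z'`, `κ = z' - σ^* z`, so `σ_! κ = 0`.
* (A) **`κ ∈ GT(X')`** (`…_sub_map_gysinMap_genericallyTorsion`, step (A) of the landed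
  `genericDivisibilityBounded_at_of_isBirational_up`): `κ ⊗ ℂ` is killed by a complex Gysin map of
  degree one (`…_gysinMap_ringChange_eq_zero`), hence dies on `(σ⁻¹U)(ℂ)`
  (`…_restrictCompl_eq_zero_of_gysinMap_eq_zero`), so `κ ⊗ ℂ ∈ N¹(X')` and `κ ∈ GT(X')`
  (`GT = N¹ ∩ H_ℤ`, the landed `…SupportedTop`).
* (B') **`D'(m, ·)` is invariant modulo `GT`** (`…_levelDivisible_of_sub_genericallyTorsion`: on
  the complement of `Z₁ ∪ Z₂` the multiplier `M N` absorbs the generically-torsion difference) and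
  **transports DOWN over the iso locus** (`…_levelDivisible_of_map_isBirational`): a relation
  `M • ((σ^* z)| - m • y) = 0` off `Z'` restricts to `(X' ∖ σ⁻¹T)(ℂ)`, `T = σ(Z') ∪ (X ∖ U)`
  (closed `≠ X`, `…_image_union_isClosed_ne_univ`), and is carried to `(X ∖ T)(ℂ)` along the
  homeomorphism `(X' ∖ σ⁻¹T)(ℂ) ≃ₜ (X ∖ T)(ℂ)` (`…_exists_homeomorph_compl`). Hence
  `D'(ℓ^s, z') ⇒ D'(ℓ^s, σ^* z) ⇒ D'(ℓ^s, z)`.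
* (C') The clean level at `X` gives `w` with `z - ℓ • w ∈ GT(X)`; pulling back (`σ` is onto,
  restriction commutes with pull-back) `σ^*(z - ℓ • w) ∈ GT(X')`, and
  `z' - ℓ • σ^* w = σ^*(z - ℓ • w) + κ ∈ GT(X')`.

## Main results

* `…_sub_map_gysinMap_genericallyTorsion` — (A); `…_levelDivisible_of_sub_genericallyTorsion`,
  `…_levelDivisible_of_map_isBirational` — (B');
* `genericDivisibilityBounded_levelClean_of_isBirational_up` — **level `ℓ^s` clean at `X` in
  degree `k ≥ 1` implies level `ℓ^s` clean at `X'`**, for `σ : X' ⟶ X` birational between smooth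
  projective `n`-folds, `k + q = 2n`; `…_levelClean_iff_of_isBirational` — with the landed
  descent, a clean level is a birational invariant; `…_levelClean_of_span` — it passes along a
  span `X ⟵σ X'' ⟶g Y`, `σ` birational, `g` onto of degree prime to `ℓ`;
* `stub_heartOfBirationalUp` — the registered signature, verbatim (`n = k = q = 2p`).

References: [VoisinHodgeI2002] §7.3.2 Lemma 7.28, proof of Thm. 7.31; [Fulton1998] Lemma 19.1.2;
[FultonYoungTableaux1997] App. B §B.1 (5)–(7); [HatcherAT2002] §3.1, §3.3 Thm. 3.30;
[ColliotTheleneVoisin2012] Thm. 2.8 (iii), Prop. 3.4; [SGA1] XII Prop. 3.1 (xi).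
-/

set_option linter.dupNamespace false

noncomputable section

namespace Summit.HodgeConjecture.HodgeConjecture.Theorems

open CategoryTheory AlgebraicGeometry
open Literature.AlgebraicGeometry.Motives Literature.AlgebraicGeometry.HodgeTheory
  Literature.AlgebraicTopology.SingularHomology

/-- Restriction `H^k(X(ℂ);ℤ) → H^k((X∖Z)(ℂ);ℤ)`, the very term of the route decls
(notation only). -/
local notation3 (prettyPrint := false) "Res[" X ", " Z ", " k "]" =>
  singularCohomology.map ℤ ℤ
    (⟨Subtype.val, continuous_subtype_val⟩ : C(complexPointsCompl X Z, ComplexPoints X)) k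

/-- The inclusion `(X ∖ Z')(ℂ) ↪ (X ∖ Z)(ℂ)` for `h : Z ⊆ Z'`, spelled as in
`genericDivisibility_restrict_restrict` (notation only). -/
local notation3 (prettyPrint := false) "Incl[" X ", " Z ", " Z' ", " h "]" =>
  (⟨fun P : complexPointsCompl X Z' => (⟨P.1, fun hP : P.1.pt ∈ Z => P.2 (h hP)⟩ :
      complexPointsCompl X Z),
    continuous_subtype_val.subtype_mk fun (P : complexPointsCompl X Z') (hP : P.1.pt ∈ Z) =>
      P.2 (h hP)⟩ : C(complexPointsCompl X Z', complexPointsCompl X Z))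

variable {n : ℕ} {X' X : SchemeOver ℂ}

/-! ### (A) `z' ≡ σ^* σ_! z'` modulo generically-torsion classes -/

/-- **`z' - σ^* σ_! z' ∈ GT(X')` for a birational `σ` (so the kernel of its integral Gysin map
`σ_!` is generically torsion: take `σ_! z' = 0`).** For `σ : X' ⟶ X` birational between smooth
projective `n`-folds, `k ≥ 1`, `k + q = 2n`,
`σ_! = gysinMap (complexOrientationInt hX') (complexOrientationInt hX) σ(ℂ)` and any
`z' ∈ H^k(X'(ℂ);ℤ)`: the class `κ = z' - σ^* σ_! z'` has `σ_! κ = 0` (`σ_! σ^* = id`,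
degree one: Fulton Lemma 19.1.2, `hasDegree_one_complexOrientationInt_of_isBirational` and
`gysinMap_map_of_hasDegree`), so `κ ⊗ ℂ` is killed by a complex Gysin map of degree one
(`genericDivisibilityBounded_gysinMap_ringChange_eq_zero`), dies on the complex points of the iso
locus (`genericDivisibilityBounded_restrictCompl_eq_zero_of_gysinMap_eq_zero`, Voisin I proof of
Thm. 7.31), lies in `N¹H^k(X'(ℂ);ℂ)`, and `κ ∈ GT(X')` (`GT = N¹ ∩ H_ℤ`).
[cite: VoisinHodgeI2002, §7.3.2 Lemma 7.28 and proof of Thm. 7.31]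
[cite: Fulton1998, Lemma 19.1.2] -/
theorem genericDivisibilityBounded_sub_map_gysinMap_genericallyTorsion
    (hX' : IsSmoothProjective n X') (hX : IsSmoothProjective n X) (σ : X' ⟶ X)
    (hσ : Literature.AlgebraicGeometry.Resolution.IsBirational σ.left) {k q : ℕ} (hk : 1 ≤ k)
    (h : k + q = 2 * n) (z' : singularCohomology ℤ ℤ (ComplexPoints X') k) :
    ∃ Z : Set X'.left, IsClosed Z ∧ Z ≠ Set.univ ∧ ∃ N : ℕ, 1 ≤ N ∧
      N • Res[X', Z, k] (z' - singularCohomology.map ℤ ℤ (AlgPoints.mapContinuous (L := ℂ) σ) k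
        (gysinMap (complexOrientationInt hX') (complexOrientationInt hX)
          (AlgPoints.mapContinuous (L := ℂ) σ) h h z')) = 0 := by
  letI := hX.chartedSpace
  letI := hX'.chartedSpace
  haveI := ComplexPoints.compactSpace_of_isSmoothProjective hX
  haveI := ComplexPoints.compactSpace_of_isSmoothProjective hX'
  haveI := ComplexPoints.t2Space_of_isSmoothProjective hX
  haveI := ComplexPoints.t2Space_of_isSmoothProjective hX'
  haveI : IsIntegral X'.left := IsSmoothProjective.isIntegral_holds hX'
  obtain ⟨U, -, hU', hiso⟩ := id hσ
  haveI : IsIso (σ.left ∣_ U) := hiso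
  set f : C(ComplexPoints X', ComplexPoints X) := AlgPoints.mapContinuous (L := ℂ) σ with hf
  -- the integral Gysin map `G = σ_!`, of degree one
  have hPDℤ : (complexOrientationInt hX).HasPoincareDuality := fun _ _ h' ↦ poincare_duality _ h'
  have hdegℤ := hasDegree_one_complexOrientationInt_of_isBirational hX' hX σ hσ
  set G := gysinMap (complexOrientationInt hX') (complexOrientationInt hX) f h h with hG
  set κ : singularCohomology ℤ ℤ (ComplexPoints X') k := z' - singularCohomology.map ℤ ℤ f k (G z')
    with hκ
  have hGκ : G κ = 0 := by
    rw [hκ, map_sub, hG, gysinMap_map_of_hasDegree hPDℤ hdegℤ h, one_smul, sub_self]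
  -- `κ ⊗ ℂ ∈ N¹(X')`, hence `κ ∈ GT(X')`
  obtain ⟨μ, ν, hdeg⟩ := exists_hasDegree_one_of_isBirational hX' hX σ hσ
  have hA := genericDivisibilityBounded_restrictCompl_eq_zero_of_gysinMap_eq_zero hX' hX σ hσ U μ ν
    hdeg h _ (genericDivisibilityBounded_gysinMap_ringChange_eq_zero hX' hX f μ ν h κ hGκ)
  have hE : IsClosed (σ.left.base ⁻¹' (U : Set X.left)ᶜ) :=
    U.2.isClosed_compl.preimage σ.left.continuous
  have hEne : σ.left.base ⁻¹' (U : Set X.left)ᶜ ≠ Set.univ := by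
    obtain ⟨x, hx⟩ := hU'.nonempty
    exact fun hu ↦ (hu ▸ Set.mem_univ x : x ∈ σ.left.base ⁻¹' (U : Set X.left)ᶜ) hx
  have hκN : singularCohomology.ringChange (Int.castRingHom ℂ) (ComplexPoints X') k κ ∈
      supportedClasses X' k 1 :=
    mem_supportedClasses_of_restrictCompl_eq_zero hE
      ((forall_one_le_coheight_iff_ne_univ hE).2 hEne) hA
  exact genericDivisibilityBounded_exists_nsmul_restrict_eq_zero_of_ringChange_mem_supportedClasses
    hX' hk hκN

/-! ### (B') The level hypothesis `D'(m, ·)` modulo `GT`, and over the iso locus -/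

/-- **`D'(m, ·)` is invariant modulo generically-torsion classes.** On an irreducible `X`: if
`M • (z|_{(X∖Z₁)(ℂ)} - m • y) = 0` (`Z₁` closed `≠ X`, `M ≥ 1`) and `N • (z - z'')|_{(X∖Z₂)(ℂ)} = 0`
(`Z₂` closed `≠ X`, `N ≥ 1`), then on the complement of `Z₁ ∪ Z₂` (closed, `≠ X` by
irreducibility) `(M N) • (z''| - m • y|) = N • (M • (z| - m • y|)) - M • (N • (z - z'')|) = 0`
(functoriality of restriction, Hatcher §3.1). [cite: HatcherAT2002, §3.1] -/
theorem genericDivisibilityBounded_levelDivisible_of_sub_genericallyTorsion {X : SchemeOver ℂ}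
    [IrreducibleSpace X.left] {k : ℕ} (m : ℕ) {z z'' : singularCohomology ℤ ℤ (ComplexPoints X) k}
    (hz : ∃ Z : Set X.left, IsClosed Z ∧ Z ≠ Set.univ ∧
      ∃ (y : singularCohomology ℤ ℤ (complexPointsCompl X Z) k) (M : ℕ), 1 ≤ M ∧
        M • (Res[X, Z, k] z - m • y) = 0)
    (hzz : ∃ Z : Set X.left, IsClosed Z ∧ Z ≠ Set.univ ∧ ∃ N : ℕ, 1 ≤ N ∧
      N • Res[X, Z, k] (z - z'') = 0) :
    ∃ Z : Set X.left, IsClosed Z ∧ Z ≠ Set.univ ∧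
      ∃ (y : singularCohomology ℤ ℤ (complexPointsCompl X Z) k) (M : ℕ), 1 ≤ M ∧
        M • (Res[X, Z, k] z'' - m • y) = 0 := by
  obtain ⟨Z₁, hZ₁, hZ₁ne, y, M, hM, hMy⟩ := hz
  obtain ⟨Z₂, hZ₂, hZ₂ne, N, hN, hNz⟩ := hzz
  refine ⟨Z₁ ∪ Z₂, hZ₁.union hZ₂, genericDivisibilityBounded_union_ne_univ hZ₁ hZ₂ hZ₁ne hZ₂ne,
    singularCohomology.map ℤ ℤ Incl[X, Z₁, Z₁ ∪ Z₂, Set.subset_union_left] k y, M * N,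
    Nat.one_le_iff_ne_zero.2 (Nat.mul_ne_zero (by omega) (by omega)), ?_⟩
  -- `M • (z| - m • y|) = 0` on the complement of `Z₁ ∪ Z₂`
  have h₁ : M • (Res[X, Z₁ ∪ Z₂, k] z -
      m • singularCohomology.map ℤ ℤ Incl[X, Z₁, Z₁ ∪ Z₂, Set.subset_union_left] k y) = 0 := by
    have h' := congrArg
      (singularCohomology.map ℤ ℤ Incl[X, Z₁, Z₁ ∪ Z₂, Set.subset_union_left] k) hMy
    rwa [map_zero, map_nsmul, map_sub, map_nsmul,
      genericDivisibility_restrict_restrict ℤ Set.subset_union_left] at h'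
  -- `N • (z - z'')| = 0` on the complement of `Z₁ ∪ Z₂`
  have h₂ : N • Res[X, Z₁ ∪ Z₂, k] (z - z'') = 0 :=
    genericDivisibilityBounded_nsmul_restrict_mono Set.subset_union_right hNz
  have e : Res[X, Z₁ ∪ Z₂, k] z'' -
      m • singularCohomology.map ℤ ℤ Incl[X, Z₁, Z₁ ∪ Z₂, Set.subset_union_left] k y =
      (Res[X, Z₁ ∪ Z₂, k] z -
        m • singularCohomology.map ℤ ℤ Incl[X, Z₁, Z₁ ∪ Z₂, Set.subset_union_left] k y) -
      Res[X, Z₁ ∪ Z₂, k] (z - z'') := by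
    rw [map_sub]
    abel
  rw [e, smul_sub, mul_smul, mul_smul, h₂, smul_zero, sub_zero, smul_comm, h₁, smul_zero]

/-- **`D'(m, ·)` transports DOWN over the iso locus of a birational morphism.** Let `σ : X' ⟶ X` be
a morphism of smooth projective `n`-folds with `σ.left` birational (an isomorphism over the dense
open `U`), `z ∈ H^k(X(ℂ);ℤ)`, and suppose `M • ((σ^* z)|_{(X'∖Z')(ℂ)} - m • y') = 0` with `Z'`
closed `≠ X'`, `M ≥ 1`. Then `D'(m, z)` holds on `X`: with `T = σ(Z') ∪ (X ∖ U)` (closed since `σ`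
is proper, `≠ X` since `σ` is injective over `U` and `X'` is irreducible:
`genericDivisibilityBounded_image_union_isClosed_ne_univ`), the relation restricts to
`(X' ∖ σ⁻¹T)(ℂ)` (`Z' ⊆ σ⁻¹T`), where `(σ^* z)| = (σ|)^*(z|_{(X∖T)(ℂ)})` (restriction commutes with
pull-back), and `σ| : (X' ∖ σ⁻¹T)(ℂ) → (X ∖ T)(ℂ)` is a homeomorphism
(`genericDivisibilityBounded_exists_homeomorph_compl`, SGA1 XII Prop. 3.1 (xi)); apply `(σ|⁻¹)^*`.
[cite: VoisinHodgeI2002, §7.3.2 proof of Thm. 7.31] [cite: SGA1, Exp. XII Prop. 3.1 (xi)]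
[cite: HatcherAT2002, §3.1] -/
theorem genericDivisibilityBounded_levelDivisible_of_map_isBirational
    (hX' : IsSmoothProjective n X') (hX : IsSmoothProjective n X) (σ : X' ⟶ X)
    (hσ : Literature.AlgebraicGeometry.Resolution.IsBirational σ.left) {k : ℕ} (m : ℕ)
    {z : singularCohomology ℤ ℤ (ComplexPoints X) k}
    (hz : ∃ Z' : Set X'.left, IsClosed Z' ∧ Z' ≠ Set.univ ∧
      ∃ (y' : singularCohomology ℤ ℤ (complexPointsCompl X' Z') k) (M : ℕ), 1 ≤ M ∧
        M • (Res[X', Z', k] (singularCohomology.map ℤ ℤ (AlgPoints.mapContinuous (L := ℂ) σ) k z) -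
          m • y') = 0) :
    ∃ Z : Set X.left, IsClosed Z ∧ Z ≠ Set.univ ∧
      ∃ (y : singularCohomology ℤ ℤ (complexPointsCompl X Z) k) (M : ℕ), 1 ≤ M ∧
        M • (Res[X, Z, k] z - m • y) = 0 := by
  haveI : IsIntegral X'.left := IsSmoothProjective.isIntegral_holds hX'
  obtain ⟨U, -, hU', hiso⟩ := hσ
  haveI : IsIso (σ.left ∣_ U) := hiso
  have hE : IsClosed (σ.left.base ⁻¹' (U : Set X.left)ᶜ) :=
    U.2.isClosed_compl.preimage σ.left.continuous
  have hEne : σ.left.base ⁻¹' (U : Set X.left)ᶜ ≠ Set.univ := by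
    obtain ⟨x, hx⟩ := hU'.nonempty
    exact fun hu ↦ (hu ▸ Set.mem_univ x : x ∈ σ.left.base ⁻¹' (U : Set X.left)ᶜ) hx
  obtain ⟨Z', hZ', hZ'ne, y, M, hM, hMy⟩ := hz
  -- the closed `T = σ(Z') ∪ (X ∖ U) ≠ X`
  have hSne : Z' ∪ σ.left.base ⁻¹' (U : Set X.left)ᶜ ≠ Set.univ :=
    genericDivisibilityBounded_union_ne_univ hZ' hE hZ'ne hEne
  obtain ⟨hT, hTne⟩ := genericDivisibilityBounded_image_union_isClosed_ne_univ hX' hX σ U hZ' hSne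
  set T : Set X.left := σ.left.base '' Z' ∪ (U : Set X.left)ᶜ with hTdef
  have hUT : (U : Set X.left)ᶜ ⊆ T := Set.subset_union_right
  have hZ'T : Z' ⊆ σ.left.base ⁻¹' T :=
    (Set.subset_preimage_image _ _).trans (Set.preimage_mono Set.subset_union_left)
  -- on `(X' ∖ σ⁻¹T)(ℂ)`: `M • ((σ^* z)| - m • y|) = 0`
  have hyT : M • (Res[X', σ.left.base ⁻¹' T, k]
      (singularCohomology.map ℤ ℤ (AlgPoints.mapContinuous (L := ℂ) σ) k z) -
        m • singularCohomology.map ℤ ℤ Incl[X', Z', σ.left.base ⁻¹' T, hZ'T] k y) = 0 := by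
    have h' := congrArg (singularCohomology.map ℤ ℤ Incl[X', Z', σ.left.base ⁻¹' T, hZ'T] k) hMy
    rwa [map_zero, map_nsmul, map_sub, map_nsmul, genericDivisibility_restrict_restrict ℤ hZ'T]
      at h'
  -- transport down along the homeomorphism `(X' ∖ σ⁻¹T)(ℂ) ≃ₜ (X ∖ T)(ℂ)`
  obtain ⟨e, he⟩ := genericDivisibilityBounded_exists_homeomorph_compl hX' hX σ U hUT
  rw [genericDivisibilityBounded_restrict_map σ T k z, ← he] at hyT
  refine ⟨T, hT, hTne, singularCohomology.map ℤ ℤ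
    (e.symm : C(complexPointsCompl X T, complexPointsCompl X' (σ.left.base ⁻¹' T))) k
      (singularCohomology.map ℤ ℤ Incl[X', Z', σ.left.base ⁻¹' T, hZ'T] k y), M, hM, ?_⟩
  have hinv (x : singularCohomology ℤ ℤ (complexPointsCompl X T) k) : singularCohomology.map ℤ ℤ
      (e.symm : C(complexPointsCompl X T, complexPointsCompl X' (σ.left.base ⁻¹' T))) k
        (singularCohomology.map ℤ ℤ
          (e : C(complexPointsCompl X' (σ.left.base ⁻¹' T), complexPointsCompl X T)) k x) = x := by
    rw [← ModuleCat.comp_apply, ← singularCohomology.map_comp, Homeomorph.toContinuousMap_comp_symm,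
      singularCohomology.map_id, ModuleCat.id_apply]
  have h'' := congrArg (singularCohomology.map ℤ ℤ
    (e.symm : C(complexPointsCompl X T, complexPointsCompl X' (σ.left.base ⁻¹' T))) k) hyT
  rwa [map_zero, map_nsmul, map_sub, map_nsmul, hinv] at h''

/-! ### (C') A clean level ascends along birational morphisms -/

/-- **A clean level ascends along birational morphisms of smooth projective varieties.** Let
`σ : X' ⟶ X` be a `ℂ`-morphism of smooth projective `n`-folds with `σ.left` birational, `k ≥ 1`,
`k + q = 2n`, and ANY `ℓ`, `s`. If level `ℓ^s` is clean at `X` in degree `k` then it is clean at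
`X'` in degree `k`. With `z = σ_! z'` (integral Gysin map for the complex orientations, degree
one) and `κ = z' - σ^* z ∈ GT(X')` (A): `D'(ℓ^s, z') ⇒ D'(ℓ^s, σ^* z)` (`D'` is invariant mod `GT`)
`⇒ D'(ℓ^s, z)` (transport down over the iso locus) (B'); the clean level at `X` gives `w` with
`z - ℓ • w ∈ GT(X)`, so `σ^*(z - ℓ • w) ∈ GT(X')` (`σ` is onto: proper birational; restriction
commutes with pull-back) and `z' - ℓ • σ^* w = σ^*(z - ℓ • w) + κ ∈ GT(X')` (C').
[cite: VoisinHodgeI2002, §7.3.2 Lemma 7.28 and proof of Thm. 7.31]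
[cite: Fulton1998, Lemma 19.1.2] [cite: ColliotTheleneVoisin2012, Thm. 2.8 (iii) and Prop. 3.4] -/
theorem genericDivisibilityBounded_levelClean_of_isBirational_up (hX' : IsSmoothProjective n X')
    (hX : IsSmoothProjective n X) (σ : X' ⟶ X)
    (hσ : Literature.AlgebraicGeometry.Resolution.IsBirational σ.left) {k q : ℕ} (hk : 1 ≤ k)
    (h : k + q = 2 * n) (ℓ s : ℕ)
    (hC : ∀ z : singularCohomology ℤ ℤ (ComplexPoints X) k,
      (∃ Z : Set X.left, IsClosed Z ∧ Z ≠ Set.univ ∧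
        ∃ (y : singularCohomology ℤ ℤ (complexPointsCompl X Z) k) (M : ℕ), 1 ≤ M ∧
          M • (Res[X, Z, k] z - ℓ ^ s • y) = 0) →
      ∃ w : singularCohomology ℤ ℤ (ComplexPoints X) k, ∃ Z : Set X.left, IsClosed Z ∧
        Z ≠ Set.univ ∧ ∃ N : ℕ, 1 ≤ N ∧ N • Res[X, Z, k] (z - ℓ • w) = 0)
    (z' : singularCohomology ℤ ℤ (ComplexPoints X') k)
    (hz' : ∃ Z : Set X'.left, IsClosed Z ∧ Z ≠ Set.univ ∧
      ∃ (y : singularCohomology ℤ ℤ (complexPointsCompl X' Z) k) (M : ℕ), 1 ≤ M ∧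
        M • (Res[X', Z, k] z' - ℓ ^ s • y) = 0) :
    ∃ w : singularCohomology ℤ ℤ (ComplexPoints X') k, ∃ Z : Set X'.left, IsClosed Z ∧
      Z ≠ Set.univ ∧ ∃ N : ℕ, 1 ≤ N ∧ N • Res[X', Z, k] (z' - ℓ • w) = 0 := by
  haveI : IsIntegral X'.left := IsSmoothProjective.isIntegral_holds hX'
  haveI : IsProper σ.left := isProper_left_of_isSmoothProjective hX' hX σ
  have hsurj : Function.Surjective σ.left.base := surjective_base_of_isBirational σ.left hσ
  -- (A) `κ = z' - σ^* z ∈ GT(X')`, `z = σ_! z'`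
  have hκ := genericDivisibilityBounded_sub_map_gysinMap_genericallyTorsion hX' hX σ hσ hk h z'
  set z : singularCohomology ℤ ℤ (ComplexPoints X) k := gysinMap (complexOrientationInt hX')
    (complexOrientationInt hX) (AlgPoints.mapContinuous (L := ℂ) σ) h h z' with hz
  -- (B') `D'(ℓ^s, z') ⇒ D'(ℓ^s, σ^* z)` (mod `GT`) `⇒ D'(ℓ^s, z)` (down over the iso locus)
  have hDz := genericDivisibilityBounded_levelDivisible_of_map_isBirational hX' hX σ hσ (ℓ ^ s)
    (genericDivisibilityBounded_levelDivisible_of_sub_genericallyTorsion (ℓ ^ s) hz' hκ)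
  -- (C') the clean level at `X`, pulled back along `σ` (onto), plus `κ`
  obtain ⟨w, T', hT', hT'ne, N', hN', hN'z⟩ := hC z hDz
  have hσz : ∃ Z : Set X'.left, IsClosed Z ∧ Z ≠ Set.univ ∧ ∃ N : ℕ, 1 ≤ N ∧
      N • Res[X', Z, k]
        (singularCohomology.map ℤ ℤ (AlgPoints.mapContinuous (L := ℂ) σ) k (z - ℓ • w)) = 0 :=
    ⟨σ.left.base ⁻¹' T', hT'.preimage σ.left.continuous,
      genericDivisibilityBounded_preimage_ne_univ σ hsurj hT'ne, N', hN', by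
        rw [genericDivisibilityBounded_restrict_map, ← map_nsmul, hN'z, map_zero]⟩
  refine ⟨singularCohomology.map ℤ ℤ (AlgPoints.mapContinuous (L := ℂ) σ) k w, ?_⟩
  have hz'eq : z' - ℓ • singularCohomology.map ℤ ℤ (AlgPoints.mapContinuous (L := ℂ) σ) k w =
      singularCohomology.map ℤ ℤ (AlgPoints.mapContinuous (L := ℂ) σ) k (z - ℓ • w) +
        (z' - singularCohomology.map ℤ ℤ (AlgPoints.mapContinuous (L := ℂ) σ) k z) := by
    rw [map_sub, map_nsmul, sub_add_sub_cancel']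
  rw [hz'eq]
  exact genericDivisibilityBounded_genericallyTorsion_add hσz hκ

/-- **A clean level is a birational invariant.** For `σ : X' ⟶ X` birational between smooth
projective `n`-folds, `k ≥ 1`, `k + q = 2n`, and any `ℓ`, `s`: level `ℓ^s` is clean at `X'` in
degree `k` iff it is clean at `X` in degree `k` (descent: the landed
`genericDivisibilityBounded_levelClean_of_isBirational`; ascent: `…_of_isBirational_up`).
[cite: VoisinHodgeI2002, §7.3.2 Lemma 7.28 and proof of Thm. 7.31]
[cite: Fulton1998, Lemma 19.1.2] -/
theorem genericDivisibilityBounded_levelClean_iff_of_isBirational (hX' : IsSmoothProjective n X')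
    (hX : IsSmoothProjective n X) (σ : X' ⟶ X)
    (hσ : Literature.AlgebraicGeometry.Resolution.IsBirational σ.left) {k q : ℕ} (hk : 1 ≤ k)
    (h : k + q = 2 * n) (ℓ s : ℕ) :
    (∀ z' : singularCohomology ℤ ℤ (ComplexPoints X') k,
      (∃ Z : Set X'.left, IsClosed Z ∧ Z ≠ Set.univ ∧
        ∃ (y : singularCohomology ℤ ℤ (complexPointsCompl X' Z) k) (M : ℕ), 1 ≤ M ∧
          M • (Res[X', Z, k] z' - ℓ ^ s • y) = 0) →
      ∃ w : singularCohomology ℤ ℤ (ComplexPoints X') k, ∃ Z : Set X'.left, IsClosed Z ∧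
        Z ≠ Set.univ ∧ ∃ N : ℕ, 1 ≤ N ∧ N • Res[X', Z, k] (z' - ℓ • w) = 0) ↔
    (∀ z : singularCohomology ℤ ℤ (ComplexPoints X) k,
      (∃ Z : Set X.left, IsClosed Z ∧ Z ≠ Set.univ ∧
        ∃ (y : singularCohomology ℤ ℤ (complexPointsCompl X Z) k) (M : ℕ), 1 ≤ M ∧
          M • (Res[X, Z, k] z - ℓ ^ s • y) = 0) →
      ∃ w : singularCohomology ℤ ℤ (ComplexPoints X) k, ∃ Z : Set X.left, IsClosed Z ∧
        Z ≠ Set.univ ∧ ∃ N : ℕ, 1 ≤ N ∧ N • Res[X, Z, k] (z - ℓ • w) = 0) :=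
  ⟨fun hC z hz ↦ genericDivisibilityBounded_levelClean_of_isBirational σ hX' hX hσ h hk ℓ s hC z hz,
    fun hC z' hz' ↦ genericDivisibilityBounded_levelClean_of_isBirational_up hX' hX σ hσ hk h ℓ s hC
      z' hz'⟩

/-- **A clean level passes along a span `X ⟵σ X'' ⟶g Y` with `σ` birational and `g` onto of degree
prime to `ℓ`.** For smooth projective `n`-folds `X`, `X''`, `Y`, `σ : X'' ⟶ X` birational,
`g : X'' ⟶ Y` onto of degree `d` for integral orientations `μ`, `ν` of `X''(ℂ)`, `Y(ℂ)`,
`gcd(ℓ, d) = 1`, `k ≥ 1`, `k + q = 2n`: level `ℓ^s` clean at `X` in degree `k` implies level `ℓ^s`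
clean at `Y` in degree `k` (ascend along `σ`,
`genericDivisibilityBounded_levelClean_of_isBirational_up`; descend along `g`, the landed
`genericDivisibilityBounded_levelClean_of_hasDegree`): the form in which the heart propagates
along dominant rational maps of degree prime to `ℓ`, once resolved.
[cite: Fulton1998, Lemma 19.1.2] [cite: FultonYoungTableaux1997, Appendix B §B.1 (5)–(7)] -/
theorem genericDivisibilityBounded_levelClean_of_span {X'' Y : SchemeOver ℂ}
    (hX : IsSmoothProjective n X) (hX'' : IsSmoothProjective n X'') (hY : IsSmoothProjective n Y)
    (σ : X'' ⟶ X) (hσ : Literature.AlgebraicGeometry.Resolution.IsBirational σ.left) (g : X'' ⟶ Y)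
    (μ : HomologicalOrientation ℤ (ComplexPoints X'') (2 * n))
    (ν : HomologicalOrientation ℤ (ComplexPoints Y) (2 * n)) {d : ℤ}
    (hdeg : HasDegree μ ν (AlgPoints.mapContinuous (L := ℂ) g) d)
    (hg : Function.Surjective g.left.base) {k q : ℕ} (hk : 1 ≤ k) (h : k + q = 2 * n) {ℓ : ℕ}
    (hℓd : IsCoprime (ℓ : ℤ) d) (s : ℕ)
    (hC : ∀ z : singularCohomology ℤ ℤ (ComplexPoints X) k,
      (∃ Z : Set X.left, IsClosed Z ∧ Z ≠ Set.univ ∧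
        ∃ (y : singularCohomology ℤ ℤ (complexPointsCompl X Z) k) (M : ℕ), 1 ≤ M ∧
          M • (Res[X, Z, k] z - ℓ ^ s • y) = 0) →
      ∃ w : singularCohomology ℤ ℤ (ComplexPoints X) k, ∃ Z : Set X.left, IsClosed Z ∧
        Z ≠ Set.univ ∧ ∃ N : ℕ, 1 ≤ N ∧ N • Res[X, Z, k] (z - ℓ • w) = 0)
    (u : singularCohomology ℤ ℤ (ComplexPoints Y) k)
    (hu : ∃ Z : Set Y.left, IsClosed Z ∧ Z ≠ Set.univ ∧
      ∃ (y : singularCohomology ℤ ℤ (complexPointsCompl Y Z) k) (M : ℕ), 1 ≤ M ∧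
        M • (Res[Y, Z, k] u - ℓ ^ s • y) = 0) :
    ∃ w : singularCohomology ℤ ℤ (ComplexPoints Y) k, ∃ Z : Set Y.left, IsClosed Z ∧
      Z ≠ Set.univ ∧ ∃ N : ℕ, 1 ≤ N ∧ N • Res[Y, Z, k] (u - ℓ • w) = 0 :=
  genericDivisibilityBounded_levelClean_of_hasDegree g hX'' hY μ ν hdeg hg h hk hℓd s
    (fun z' hz' ↦ genericDivisibilityBounded_levelClean_of_isBirational_up hX'' hX σ hσ hk h ℓ s hC
      z' hz') u hu

/-! ### The registered sub-goal -/

/-- **Registered sub-goal `stub_heartOfBirationalUp` of stmt-HodgeConjecture-18467 (lead c5, line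
`finite-level-bootstrap`): the heart ASCENDS along birational morphisms of smooth projective
`2p`-folds** — for `σ : X' ⟶ X` birational (`p ≥ 1`) and any `ℓ`, `s`, level `ℓ^s` clean at `X`
implies level `ℓ^s` clean at `X'`; with the landed descent
(`genericDivisibilityBounded_levelClean_of_isBirational`) the heart `stub_finiteLevel` at `(ℓ, s)`
is a birational invariant. Proof: `genericDivisibilityBounded_levelClean_of_isBirational_up` at
`n = k = q = 2p`. [cite: VoisinHodgeI2002, §7.3.2 Lemma 7.28 and proof of Thm. 7.31]
[cite: Fulton1998, Lemma 19.1.2] -/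
theorem stub_heartOfBirationalUp :
    ∀ ⦃p : ℕ⦄ ⦃X' X : SchemeOver ℂ⦄ (σ : X' ⟶ X), 1 ≤ p → IsSmoothProjective (2 * p) X' →
      IsSmoothProjective (2 * p) X → Literature.AlgebraicGeometry.Resolution.IsBirational σ.left →
      ∀ ℓ s : ℕ,
      (∀ z : singularCohomology ℤ ℤ (ComplexPoints X) (2 * p),
        (∃ Z : Set X.left, IsClosed Z ∧ Z ≠ Set.univ ∧
          ∃ (y : singularCohomology ℤ ℤ (complexPointsCompl X Z) (2 * p)) (M : ℕ), 1 ≤ M ∧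
            M • (singularCohomology.map ℤ ℤ
              (⟨Subtype.val, continuous_subtype_val⟩ : C(complexPointsCompl X Z, ComplexPoints X))
              (2 * p) z - ℓ ^ s • y) = 0) →
        ∃ w : singularCohomology ℤ ℤ (ComplexPoints X) (2 * p),
          ∃ Z : Set X.left, IsClosed Z ∧ Z ≠ Set.univ ∧ ∃ N : ℕ, 1 ≤ N ∧
            N • singularCohomology.map ℤ ℤ
              (⟨Subtype.val, continuous_subtype_val⟩ : C(complexPointsCompl X Z, ComplexPoints X))
              (2 * p) (z - ℓ • w) = 0) →
      ∀ z' : singularCohomology ℤ ℤ (ComplexPoints X') (2 * p),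
        (∃ Z : Set X'.left, IsClosed Z ∧ Z ≠ Set.univ ∧
          ∃ (y : singularCohomology ℤ ℤ (complexPointsCompl X' Z) (2 * p)) (M : ℕ), 1 ≤ M ∧
            M • (singularCohomology.map ℤ ℤ
              (⟨Subtype.val, continuous_subtype_val⟩ : C(complexPointsCompl X' Z, ComplexPoints X'))
              (2 * p) z' - ℓ ^ s • y) = 0) →
        ∃ w : singularCohomology ℤ ℤ (ComplexPoints X') (2 * p),
          ∃ Z : Set X'.left, IsClosed Z ∧ Z ≠ Set.univ ∧ ∃ N : ℕ, 1 ≤ N ∧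
            N • singularCohomology.map ℤ ℤ
              (⟨Subtype.val, continuous_subtype_val⟩ : C(complexPointsCompl X' Z, ComplexPoints X'))
              (2 * p) (z' - ℓ • w) = 0 :=
  fun p _ _ σ hp hX' hX hσ ℓ s hC z' hz' ↦
    genericDivisibilityBounded_levelClean_of_isBirational_up hX' hX σ hσ (k := 2 * p) (q := 2 * p)
      (by omega) (by omega) ℓ s hC z' hz'

end Summit.HodgeConjecture.HodgeConjecture.Theorems

end
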